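import Literature.Computability.Complexity.IteratedAdditionTC0
import Literature.Computability.Cryptography.NaorReingoldTC0Stages
import HarnessLib

/-!
# The Naor–Reingold functions in `TC⁰`, II: the circuit

The constant-depth threshold circuit for one output bit of `f_{P,Q,g,ā}(x) = g^{a₀ ∏_{xᵢ=1} aᵢ}`
(Naor–Reingold 2004, Thm. 4.5), assembled in the realizability calculus `ACVecOver` /
`ACRealOver` over `tcBasis` from the layers of `TCResidueLayer.lean` (CRT data of a selected
product, depth `9` each) and the iterated-addition circuit of `IteratedAdditionTC0.lean`
(depth `9`), following the arithmetic of `NaorReingoldTC0Stages.lean`: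

  inputs `x` ─(CRT layer for `E(x) = a₀ ∏ a_{i+1}`)→ wires `y₁` ─(CRT layer for the selected product
  `Π₂ ≡ g^E` of preprocessed powers)→ wires `y₂ = wiresD x` ─(for each candidate quotient `q`:
  the bits of `V_q = 2^W − qP + U`, `U = ∑ numD · y₂ ≡ f(x) (mod P)`, by iterated addition of the
  selected hard-wired numbers)→ bit wires ─(`∃ q, bit_W(V_q) ∧ ¬bit_W(V_{q+1}) ∧ bit_j(V_q)`)→
  bit `j` of `f(x)`.

Total depth `30` (`acRealOver_nrBit`), size `nrSize n`, a function of `n` alone; that `nrSize` is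
polynomially bounded, and the named fact `NaorReingold2004_thm45` itself, are in
`NaorReingoldTC0Size.lean`.

## References

* M. Naor, O. Reingold, *Number-theoretic constructions of efficient pseudo-random functions*,
  J. ACM 51 (2004), §4.2–4.2.1 (pp. 251–252), Thm. 4.5.
* H. Vollmer, *Introduction to Circuit Complexity* (1999), Thm. 1.37, Thm. 1.40.
-/

noncomputable section

namespace Literature.Computability.Cryptography

open Finset Complexity Complexity.SmallPrimes Complexity.ItAdd

namespace NRTC0

variable {n P Q g : ℕ}

/-! ### Reading a bit of `U mod P` off the candidates `2^W − q P + U` -/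

/-- **The final selection**: for `U < qm · P ≤ 2^W`, `0 < P`, `j < W`, bit `j` of `U mod P` is
`∃ q < qm, bit_W(2^W − qP + U) ∧ ¬ bit_W(2^W − (q+1)P + U) ∧ bit_j(2^W − qP + U)` (the
comparisons `qP ≤ U < (q+1)P` are the top bits; cf. Vollmer's determination of the CRT quotient
`q` by the parallel comparisons `i·p ≤ a' < (i+1)·p`). [cite: Vollmer1999, §1.4.2, proof of Thm. 1.40] -/
theorem testBit_mod_eq_exists {U P W j qm : ℕ} (hP : 0 < P) (hU : U < qm * P)
    (hW : qm * P ≤ 2 ^ W) (hj : j < W) :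
    (U % P).testBit j = decide (∃ q : Fin qm,
      (2 ^ W - (q : ℕ) * P + U).testBit W = true ∧
      (2 ^ W - ((q : ℕ) + 1) * P + U).testBit W = false ∧
      (2 ^ W - (q : ℕ) * P + U).testBit j = true) := by
  have hqP : ∀ q, q ≤ qm → q * P ≤ 2 ^ W := fun q hq =>
    (Nat.mul_le_mul_right _ hq).trans hW
  have hU2 : U < 2 ^ W := hU.trans_le hW
  -- the top bit of a number below `2^(W+1)` tells whether it is at least `2^W`
  -- (as `Literature.Computability.Complexity.testBit_eq_decide_le` of `NCThreshold.lean`, not imported here)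
  have key : ∀ V, V < 2 ^ (W + 1) → V.testBit W = decide (2 ^ W ≤ V) := by
    intro V hV
    rw [Nat.testBit_eq_decide_div_mod_eq]
    have h2 : V / 2 ^ W < 2 := by
      rw [Nat.div_lt_iff_lt_mul (Nat.two_pow_pos W)]; rwa [pow_succ'] at hV
    by_cases hle : 2 ^ W ≤ V
    · have h1 : 1 ≤ V / 2 ^ W := (Nat.le_div_iff_mul_le (Nat.two_pow_pos W)).2 (by simpa)
      have : V / 2 ^ W = 1 := by omega
      simp [this, hle]
    · have : V / 2 ^ W = 0 := Nat.div_eq_of_lt (Nat.lt_of_not_le hle)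
      simp [this, hle]
  have htop : ∀ q, q ≤ qm → (2 ^ W - q * P + U).testBit W = decide (q * P ≤ U) := by
    intro q hq
    have hqW := hqP q hq
    rw [key _ (by rw [pow_succ]; omega)]
    by_cases hc : q * P ≤ U
    · rw [decide_eq_true hc, decide_eq_true (by omega)]
    · rw [decide_eq_false hc, decide_eq_false (by omega)]
  set q₀ := U / P with hq₀
  have hq₀lt : q₀ < qm := by rwa [hq₀, Nat.div_lt_iff_lt_mul hP]
  have hq₀P : q₀ * P ≤ U := Nat.div_mul_le_self U P
  have hq₀P' : U < (q₀ + 1) * P := by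
    have := Nat.lt_div_mul_add (a := U) hP
    rw [hq₀]; linarith
  have hmod : U % P = U - q₀ * P := by
    rw [hq₀, Nat.mod_def, mul_comm]
  have hV : 2 ^ W - q₀ * P + U = 2 ^ W + U % P := by
    have := hqP q₀ hq₀lt.le
    omega
  rw [Bool.eq_iff_iff, decide_eq_true_eq]
  constructor
  · intro hbit
    refine ⟨⟨q₀, hq₀lt⟩, ?_, ?_, ?_⟩
    · rw [htop q₀ hq₀lt.le, decide_eq_true hq₀P]
    · rw [htop (q₀ + 1) hq₀lt, decide_eq_false (not_le.2 hq₀P')]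
    · rw [hV, Nat.testBit_two_pow_add_gt hj]; exact hbit
  · rintro ⟨q, h1, h2, h3⟩
    have hq : (q : ℕ) ≤ qm := q.2.le
    rw [htop q hq, decide_eq_true_eq] at h1
    rw [htop (q + 1) q.2] at h2
    have h2' : U < ((q : ℕ) + 1) * P := by
      by_contra hc
      rw [decide_eq_true (not_lt.1 hc)] at h2
      exact Bool.noConfusion h2
    have hqq : (q : ℕ) = q₀ := by
      rw [hq₀]
      exact (Nat.div_eq_of_lt_le h1 h2').symm
    rw [hqq, hV, Nat.testBit_two_pow_add_gt hj] at h3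
    exact h3

/-- The same selection as an `↔`. [cite: Vollmer1999, §1.4.2, proof of Thm. 1.40] -/
theorem testBit_mod_iff {U P W j qm : ℕ} (hP : 0 < P) (hU : U < qm * P)
    (hW : qm * P ≤ 2 ^ W) (hj : j < W) :
    (U % P).testBit j = true ↔ ∃ q : Fin qm,
      (2 ^ W - (q : ℕ) * P + U).testBit W = true ∧
      (2 ^ W - ((q : ℕ) + 1) * P + U).testBit W = false ∧
      (2 ^ W - (q : ℕ) * P + U).testBit j = true := by
  rw [testBit_mod_eq_exists hP hU hW hj, decide_eq_true_eq]

/-! ### Adding selected hard-wired numbers: generic layers -/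

section Generic

variable {W : Type}

/-- Bit `t` of a summand: of the offset `off` (`none`), or of `num w` masked by the wire `w`. [folklore] -/
def xbitG (off : ℕ) (num : W → ℕ) (y : W → Bool) : Option W → ℕ → Bool
  | none, t => off.testBit t
  | some w, t => y w && (num w).testBit t

/-- `xbitG` at the offset. [folklore] -/
theorem xbitG_none (off : ℕ) (num : W → ℕ) (y : W → Bool) (t : ℕ) :
    xbitG off num y none t = off.testBit t := rfl

/-- `xbitG` at a wire. [folklore] -/
theorem xbitG_some (off : ℕ) (num : W → ℕ) (y : W → Bool) (w : W) (t : ℕ) :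
    xbitG off num y (some w) t = (y w && (num w).testBit t) := rfl

/-- The bit matrix handed to the iterated-addition circuit (`N` summands of `WU` bits, enumerated
by `e`). [folklore] -/
def XbitsG {N WU : ℕ} (e : Fin N ≃ Option W) (off : ℕ) (num : W → ℕ) (y : W → Bool)
    (k : Fin N × Fin WU) : Bool :=
  xbitG off num y (e k.1) k.2

/-- The value of a number from its low `W` bits. [folklore] -/
theorem sum_testBit_toNat_mul (m K : ℕ) :
    (∑ t : Fin K, (m.testBit t).toNat * 2 ^ (t : ℕ)) = m % 2 ^ K := by
  induction K with
  | zero => simp [Nat.mod_one]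
  | succ K ih =>
    rw [Fin.sum_univ_castSucc]
    simp only [Fin.val_castSucc, Fin.val_last]
    rw [ih, Nat.mod_pow_succ, Nat.testBit_eq_decide_div_mod_eq]
    rcases Nat.mod_two_eq_zero_or_one (m / 2 ^ K) with h | h
    · simp [h]
    · simp [h, mul_comm]

/-- The value of a masked number from its low bits. [folklore] -/
theorem sum_and_testBit_toNat_mul (b : Bool) (m K : ℕ) :
    (∑ t : Fin K, (b && m.testBit t).toNat * 2 ^ (t : ℕ)) = b.toNat * (m % 2 ^ K) := by
  cases b
  · simp
  · simp only [Bool.true_and, Bool.toNat_true, one_mul]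
    exact sum_testBit_toNat_mul m K

/-- **The sum of the summands**: `total = off mod 2^{WU} + ∑_w [y w] (num w mod 2^{WU})`. [folklore] -/
theorem total_XbitsG [Fintype W] {N WU : ℕ} (e : Fin N ≃ Option W) (off : ℕ) (num : W → ℕ) (y : W → Bool) :
    total (XbitsG (WU := WU) e off num y) =
      off % 2 ^ WU + ∑ w, (y w).toNat * (num w % 2 ^ WU) := by
  have h1 : total (XbitsG (WU := WU) e off num y) =
      ∑ o : Option W, ∑ t : Fin WU, (xbitG off num y o t).toNat * 2 ^ (t : ℕ) := by
    unfold ItAdd.total ItAdd.val XbitsG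
    exact e.sum_comp (fun o => ∑ t : Fin WU, (xbitG off num y o t).toNat * 2 ^ (t : ℕ))
  rw [h1, Fintype.sum_option]
  have h2 : (∑ t : Fin WU, (xbitG off num y none t).toNat * 2 ^ (t : ℕ)) = off % 2 ^ WU := by
    simp only [xbitG_none]; exact sum_testBit_toNat_mul off WU
  have h3 : ∀ w, (∑ t : Fin WU, (xbitG off num y (some w) t).toNat * 2 ^ (t : ℕ)) =
      (y w).toNat * (num w % 2 ^ WU) := fun w => by
    simp only [xbitG_some]; exact sum_and_testBit_toNat_mul (y w) (num w) WU
  rw [h2, Finset.sum_congr rfl fun w _ => h3 w]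

/-- **The candidates**: if the offset and the numbers fit in `WU` bits then
`total = off + ∑_w num w · [y w]`. [folklore] -/
theorem total_XbitsG_eq [Fintype W] {N WU : ℕ} (e : Fin N ≃ Option W) {off : ℕ} {num : W → ℕ}
    (hoff : off < 2 ^ WU) (hnum : ∀ w, num w < 2 ^ WU) (y : W → Bool) :
    total (XbitsG (WU := WU) e off num y) = off + wsum num y := by
  have hsum : (∑ w, (y w).toNat * (num w % 2 ^ WU)) = wsum num y := by
    unfold wsum
    refine Finset.sum_congr rfl fun w _ => ?_
    rw [Nat.mod_eq_of_lt (hnum w), mul_comm]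
  rw [total_XbitsG, Nat.mod_eq_of_lt hoff, hsum]

/-- One summand bit is a literal, a masked literal or a constant: depth `≤ 1`, `≤ 1` gate. [folklore] -/
theorem acRealOver_xbitG (off : ℕ) (num : W → ℕ) (o : Option W) (t : ℕ) :
    ACRealOver tcBasis (fun y : W → Bool => xbitG off num y o t) 1 1 := by
  cases o with
  | none =>
    exact (acRealOver_const acBasis_subset_tcBasis (off.testBit t)).congr fun y =>
      (xbitG_none off num y t).symm
  | some w =>
    cases hb : (num w).testBit t
    · exact (acRealOver_const acBasis_subset_tcBasis false).congr fun y => by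
        rw [xbitG_some, hb, Bool.and_false]
    · exact ((acRealOver_input tcBasis w).mono zero_le_one zero_le_one).congr fun y => by
        rw [xbitG_some, hb, Bool.and_true]

/-- The bit matrix as a layer over the wires: depth `1`. [folklore] -/
theorem acVecOver_XbitsG {N WU : ℕ} (e : Fin N ≃ Option W) (off : ℕ) (num : W → ℕ) :
    ACVecOver tcBasis (XbitsG (WU := WU) e off num) 1 (Fintype.card (Fin N × Fin WU) * 1) :=
  acVecOver_ofBlocks_fintype_const (κ := Fin N × Fin WU)
    (f := fun k y => XbitsG e off num y k) fun k => acRealOver_xbitG off num (e k.1) k.2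

/-- Size of one candidate adder (with its bit matrix). [folklore] -/
def candSizeG (N WU W' : ℕ) : ℕ := itAddSize N W' + Fintype.card (Fin N × Fin WU) * 1

/-- **The bits of a candidate** `total (XbitsG e off num y)`, positions `< W'`, at depth `10` over
the wires (iterated addition, Vollmer Thm. 1.37, on top of the bit matrix). [cite: Vollmer1999, Thm. 1.37] -/
theorem acVecOver_candBitsG {N WU : ℕ} (e : Fin N ≃ Option W) (off : ℕ) (num : W → ℕ) (W' : ℕ) :
    ACVecOver tcBasis (fun (y : W → Bool) (t : Fin W') =>
      (total (XbitsG (WU := WU) e off num y)).testBit t) 10 (candSizeG N WU W') :=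
  (acVecOver_XbitsG e off num).iteratedAdd W'

/-- The bit wires read by the final formula: for `q ≤ qm`, the comparison bit (`true`, position
`Wt`) and bit `j` (`false`) of the candidate with offset `offF q`. [folklore] -/
def bitsFG {N WU : ℕ} (e : Fin N ≃ Option W) (offF : ℕ → ℕ) (num : W → ℕ) (Wt j qm : ℕ)
    (y : W → Bool) (qb : Fin (qm + 1) × Bool) : Bool :=
  (total (XbitsG (WU := WU) e (offF qb.1) num y)).testBit (if qb.2 = true then Wt else j)

/-- Size of the bit-wire layer. [folklore] -/
def bitsSizeG (N WU W' qm : ℕ) : ℕ := Fintype.card (Fin (qm + 1) × Bool) * candSizeG N WU W'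

/-- The bit-wire layer, depth `10` over the wires. [folklore] -/
theorem acVecOver_bitsFG {N WU : ℕ} (e : Fin N ≃ Option W) (offF : ℕ → ℕ) (num : W → ℕ)
    {Wt j W' : ℕ} (hWt : Wt < W') (hj : j < W') (qm : ℕ) :
    ACVecOver tcBasis (bitsFG (WU := WU) e offF num Wt j qm) 10 (bitsSizeG N WU W' qm) := by
  refine acVecOver_ofBlocks_fintype_const (κ := Fin (qm + 1) × Bool)
    (f := fun qb y => bitsFG (WU := WU) e offF num Wt j qm y qb) fun qb => ?_
  have h := (acVecOver_candBitsG (WU := WU) e (offF qb.1) num W').proj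
    ⟨if qb.2 = true then Wt else j, by split <;> omega⟩
  exact h.congr fun y => rfl

/-- The final formula on the bit wires `z (q, b)`:
`∃ q < qm, z(q, cmp) ∧ ¬ z(q+1, cmp) ∧ z(q, bit)`. [folklore] -/
def selF (qm : ℕ) (z : Fin (qm + 1) × Bool → Bool) : Bool :=
  decide (∃ q : Fin qm, z (q.castSucc, true) = true ∧ z (q.succ, true) = false ∧
    z (q.castSucc, false) = true)

/-- The final formula is an `∨` of `qm` ternary `∧`s of literals: depth `2`, `2 qm + 1` gates. [folklore] -/
theorem acRealOver_selF (qm : ℕ) :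
    ACRealOver tcBasis (selF qm : (Fin (qm + 1) × Bool → Bool) → Bool) 2 (qm * 2 + 1) := by
  have hblk : ∀ q : Fin qm, ACRealOver tcBasis (fun z : Fin (qm + 1) × Bool → Bool =>
      z (q.castSucc, true) && !z (q.succ, true) && z (q.castSucc, false)) 1 2 := fun q =>
    (ACRealOver.and₃ acBasis_subset_tcBasis (acRealOver_input tcBasis _)
      (acRealOver_notInput not_mem_tcBasis _) (acRealOver_input tcBasis _)).mono le_rfl le_rfl
  have h := acRealOver_exists_const acBasis_subset_tcBasis hblk
  refine h.congr fun z => ?_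
  unfold selF
  rw [decide_eq_decide]
  simp only [Bool.and_eq_true, Bool.not_eq_true', and_assoc]

/-- **Semantics of the formula on the bit wires**: with offsets and numbers fitting in `WU` bits,
the formula tests `∃ q < qm, bit_Wt(offF q + U) ∧ ¬ bit_Wt(offF (q+1) + U) ∧ bit_j(offF q + U)`,
`U = ∑_w num w · [y w]`. [folklore] -/
theorem selF_bitsFG_iff [Fintype W] {N WU : ℕ} (e : Fin N ≃ Option W) {offF : ℕ → ℕ} {num : W → ℕ}
    (hoff : ∀ q, offF q < 2 ^ WU) (hnum : ∀ w, num w < 2 ^ WU) (Wt j qm : ℕ) (y : W → Bool) :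
    selF qm (bitsFG (WU := WU) e offF num Wt j qm y) = true ↔ ∃ q : Fin qm,
      (offF q + wsum num y).testBit Wt = true ∧
      (offF ((q : ℕ) + 1) + wsum num y).testBit Wt = false ∧
      (offF q + wsum num y).testBit j = true := by
  unfold selF bitsFG
  rw [decide_eq_true_eq]
  simp only [total_XbitsG_eq e (hoff _) hnum, Fin.val_castSucc, Fin.val_succ, if_true,
    Bool.false_eq_true, if_false]

end Generic

/-! ### The widths and the summands of the Naor–Reingold circuit -/

/-- The input width of the adders: every hard-wired summand is `< 2^{WU}`. [folklore] -/
def WU (n : ℕ) : ℕ := n + quotRange (S₂ n).card + (S₂ n).card + 1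

/-- The position of the comparison bit: `qmax · P ≤ 2^{Wtop}`. [folklore] -/
def Wtop (n : ℕ) : ℕ := n + qmax n

/-- The number of summands: the wires and the offset. [folklore] -/
def Nn (n : ℕ) : ℕ := Fintype.card (Option (WiresD n))

/-- The enumeration of the summands. [folklore] -/
def eW (n : ℕ) : Fin (Nn n) ≃ Option (WiresD n) := (Fintype.equivFin (Option (WiresD n))).symm

/-- `Wtop < WU`. [folklore] -/
theorem Wtop_lt_WU (n : ℕ) : Wtop n < WU n := by
  unfold Wtop WU qmax quotRange
  nlinarith

/-- Every hard-wired summand fits: `numD w < 2^{WU}` (for `0 < P < 2^n`). [folklore] -/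
theorem numD_lt_two_pow_WU (hP0 : 0 < P) (hP : P < 2 ^ n) (w : WiresD n) :
    numD n P w < 2 ^ WU n := by
  cases w with
  | inl v =>
    rw [numD_inl]
    have h1 : ((v : ℕ) + (S₂ n).card) / 2 ^ apxB (S₂ n) ≤ (v : ℕ) + (S₂ n).card :=
      Nat.div_le_self _ _
    have h2 : (v : ℕ) + (S₂ n).card < quotRange (S₂ n).card + (S₂ n).card := by
      have := v.2; omega
    have h3 : quotRange (S₂ n).card + (S₂ n).card < 2 ^ (quotRange (S₂ n).card + (S₂ n).card) :=
      Nat.lt_two_pow_self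
    calc ((v : ℕ) + (S₂ n).card) / 2 ^ apxB (S₂ n) * (P - crtM (S₂ n) % P)
        ≤ (quotRange (S₂ n).card + (S₂ n).card) * 2 ^ n :=
          Nat.mul_le_mul (h1.trans h2.le) ((Nat.sub_le _ _).trans hP.le)
      _ < 2 ^ (quotRange (S₂ n).card + (S₂ n).card) * 2 ^ n :=
          Nat.mul_lt_mul_of_pos_right h3 (Nat.two_pow_pos n)
      _ ≤ 2 ^ WU n := by
          rw [← pow_add]; exact Nat.pow_le_pow_right two_pos (by unfold WU; omega)
  | inr q =>
    rw [numD_inr]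
    calc crtT (S₂ n) q.1 q.2 % P < P := Nat.mod_lt _ hP0
      _ ≤ 2 ^ n := hP.le
      _ ≤ 2 ^ WU n := Nat.pow_le_pow_right two_pos (by unfold WU; omega)

/-- The offsets `2^{Wtop} − qP` fit. [folklore] -/
theorem offset_lt_two_pow_WU (n P q : ℕ) : 2 ^ Wtop n - q * P < 2 ^ WU n :=
  (Nat.sub_le _ _).trans_lt (Nat.pow_lt_pow_right one_lt_two (Wtop_lt_WU n))

/-- `qmax · P ≤ 2^{Wtop}`. [folklore] -/
theorem qmax_mul_le (hP : P < 2 ^ n) : qmax n * P ≤ 2 ^ Wtop n := by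
  unfold Wtop
  rw [pow_add]
  calc qmax n * P ≤ 2 ^ qmax n * 2 ^ n :=
        Nat.mul_le_mul (Nat.lt_two_pow_self).le hP.le
    _ = 2 ^ n * 2 ^ qmax n := mul_comm _ _

/-! ### The circuit and its correctness -/

/-- Size of the two CRT layers. [folklore] -/
def wiresSize (n : ℕ) : ℕ :=
  crtLayerSize (Fintype.card (WiresB n)) (S₂ n).card (L₂ n) + crtLayerSize n (S₁ n).card (L₁ n)

/-- **The stage-D wires as a layer over the inputs**: depth `18`. [cite: NaorReingold2004, §4.2.1 (p. 252)] -/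
theorem acVecOver_wiresD (a : Fin (n + 1) → ℕ) :
    ACVecOver tcBasis (wiresD n P Q g a) 18 (wiresSize n) := by
  have h1 := crtLayer (F := Fin n) (a 0) (fun i => a i.succ) (fun _ hp => (mem_primeSet.1 hp).2)
    (primeSet_le (B₁ n))
  have h2 := crtLayer (F := WiresB n) 1 (factorB n P Q g) (fun _ hp => (mem_primeSet.1 hp).2)
    (primeSet_le (B₂ n))
  have h := h2.comp h1
  refine (h.congr fun x w => rfl).mono le_rfl ?_
  unfold wiresSize
  simp only [Fintype.card_fin]
  rfl

/-- The total size of the circuit for one output bit. [folklore] -/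
def nrSize (n : ℕ) : ℕ :=
  qmax n * 2 + 1 + bitsSizeG (Nn n) (WU n) (Wtop n + 1) (qmax n) + wiresSize n

/-- The Boolean function computed by the circuit for bit `j`. [folklore] -/
def nrBit (n P Q g : ℕ) (a : Fin (n + 1) → ℕ) (j : ℕ) (x : Fin n → Bool) : Bool :=
  selF (qmax n) (bitsFG (WU := WU n) (eW n) (fun q => 2 ^ Wtop n - q * P) (numD n P) (Wtop n) j
    (qmax n) (wiresD n P Q g a x))

/-- **The circuit for bit `j`** as a realization over the inputs: depth `30`, `nrSize n` gates. [cite: NaorReingold2004, Thm. 4.5 (p. 252)] -/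
theorem acRealOver_nrBit (a : Fin (n + 1) → ℕ) {j : ℕ} (hj : j < Wtop n + 1) :
    ACRealOver tcBasis (nrBit n P Q g a j) 30 (nrSize n) :=
  ((acRealOver_selF (qmax n)).compVec (acVecOver_bitsFG (WU := WU n) (eW n)
    (fun q => 2 ^ Wtop n - q * P) (numD n P) (Nat.lt_succ_self _) hj (qmax n))).compVec
    (acVecOver_wiresD a)

/-- **Correctness**: on an instance key, the circuit outputs bit `j` of `f_{P,Q,g,ā}(x)`. [cite: NaorReingold2004, Thm. 4.5 (p. 252)] -/
theorem nrBit_eq (h : IsDDHInstance n P Q g) {a : Fin (n + 1) → ℕ} (ha : ∀ i, a i < Q)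
    (j : Fin n) (x : Fin n → Bool) : nrBit n P Q g a j x = (nrFun P g a x).val.testBit j := by
  have hP := h.lt_two_pow
  have hP0 := h.prime_P.pos
  have hjW : (j : ℕ) < Wtop n := by have := j.2; unfold Wtop; omega
  rw [Bool.eq_iff_iff, nrBit, selF_bitsFG_iff (eW n) (fun q => offset_lt_two_pow_WU n P q)
    (numD_lt_two_pow_WU hP0 hP) (Wtop n) j (qmax n), val_nrFun_eq h ha x,
    testBit_mod_iff hP0 (wsum_numD_lt h a x) (qmax_mul_le hP) hjW]

end NRTC0

end Literature.Computability.Cryptography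

end
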